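import Mathlib
import Literature.Combinatorics.Enumerative.SnakesSpringerNumbers
import HarnessLib

/-!
# Snakes of type `Dₙ` and Hoffman's Theorem 4.3: `card βₙ = card Bₙ + card Dₙ`

[cite: Hoffman1999DerivativePolynomials, §4 Definition (snakes of type Dₙ) and Theorem 4.3 with its proof (Electron. J. Combin. 6 (1999) #R21, pp. 7–8)]
[cite: Arnold1992Snakes (the snakes of types A, B, D, β and the Springer numbers aₙ, bₙ, dₙ)]

Continues `SnakesSpringerNumbers` (signed arrangements, `betaSnakes`, `bSnakes`, Theorem 4.2: `card βₙ = Pₙ(1)`,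
`card Bₙ = Qₙ(1)`) with the third family of Arnol'd's snakes and Hoffman's bijective proof of Theorem 4.3.

## Source (verbatim)

* «A snake of type Dₙ is a sequence (x₁, …, xₙ) of integers such that −x₂ < x₁ < x₂ > x₃ < ⋯ xₙ and
  {|x₁|, |x₂|, …, |xₙ|} = {0, 1, …, n − 1}.»
* «Theorem 4.3. card βₙ = card Bₙ + card Dₙ (so card Dₙ = Pₙ(1) − Qₙ(1)).
  Proof. First note that we have a partition βₙ = βₙ⁻ ∪ βₙ⁺, where βₙ⁻ and βₙ⁺ are respectively the sets of βₙ-snakes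
  that start with a negative integer and with a positive integer. We shall define bijections f : βₙ⁻ → Bₙ and
  g : βₙ⁺ → Dₙ. Let f(x₁, …, xₙ) = (−x₁, …, −xₙ): it is easy to see that f is a bijection of βₙ⁻ onto Bₙ. For g,
  let (x₁, …, xₙ) ∈ βₙ⁺, with r ∈ {1, …, n} such that |x_r| = 1. Then g(x₁, …, xₙ) = (x_r x̃₁, x̃₂, …, x̃ₙ), where
  x̃ᵢ = (sgn xᵢ)(|xᵢ| − 1). The reader may verify that the image of g is in Dₙ, and in fact that g has an inverse
  given by g⁻¹(y₁, …, yₙ) = (1, ŷ₂, …, ŷₙ), if r = 1; (|ŷ₁|, ŷ₂, …, ŷ_{r−1}, sgn y₁, ŷ_{r+1}, …, ŷₙ), otherwise;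
  for (y₁, …, yₙ) ∈ Dₙ with y_r = 0, and ŷᵢ = (sgn yᵢ)(|yᵢ| + 1) for i ≠ r.»

## What is typed, and how (the printed proof, with «the reader may verify» verified)

* §1 `dSnakes T` (snakes of type `D` on the absolute values `T`; Hoffman's `Dₙ = dSnakes (range n)`), the halves
  `betaSnakesPos`/`betaSnakesNeg` of `betaSnakes S` by the sign of the first letter, `card β = card β⁺ + card β⁻`;
  `D₁, D₂, D₃` by enumeration (`dSnakes_small_counts`).
* §2 `f = −` : `card βₙ⁻(S) = card B(S)` for `0 ∉ S ≠ ∅` (`card_betaSnakesNeg`, an involution; `zigzagWord_map_neg`).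
* §3 `g` and `g⁻¹` written with `shrink x = (sgn x)(|x|−1)`, `grow δ y = (sgn y)(|y|+1)` (`y ≠ 0`), `grow δ 0 = δ`:
  `gMap (x₁ :: t) = (x_r·x̃₁) :: t.map shrink` with `x_r = signOfOne x` the sign of the letter `±1`, and
  `gInv (y₁ :: t) = |ŷ₁| :: t.map (grow (sgn y₁))` (`sgn 0 := 1` covers the case `r = 1`).  Verified:
  `gMap_mem` (image in `Dₙ`: `shrink` is strictly increasing on letters with distinct nonzero absolute values, and
  `|x_r x̃₁| = x̃₁ < x̃₂`), `gInv_mem` (`grow δ` is strictly increasing, `|ŷ₁| = |y₁| + 1 < y₂ + 1`), `gInv_gMap`,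
  `gMap_gInv` (the letter `0` of a `Dₙ`-snake carries the sign of `y₁` back), hence
  `card_betaSnakesPos_eq_card_dSnakes` (`Finset.card_nbij'`).
* §4 **Theorem 4.3** `card_betaSnakes_eq_card_bSnakes_add_card_dSnakes` and `card Dₙ = Pₙ(1) − Qₙ(1)`
  (`card_dSnakes_range`, with Theorem 4.2 of the previous file), values `1, 1, 5, 23, 151, 1141`, and the
  exponential generating function `Σ_{n≥1} card Dₙ tⁿ/n! = P(1,t) − Q(1,t)` (`egf_dSnakes`).

All statements for `n ≥ 1` (`D₀ = β₀ = B₀ = {()}`).  No new named facts (net debt 0).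
-/

namespace Literature.Combinatorics.Enumerative
namespace Snakes

open List
open Literature.ComputerArithmetic.BrentZimmermann2010

/-! ### §1 Snakes of type `Dₙ`; the two halves `βₙ⁺`, `βₙ⁻` of the `β`-snakes -/

/-- The extra condition `−x₂ < x₁` of a snake of type `D` (vacuous for words of length `≤ 1`).
[cite: Hoffman1999DerivativePolynomials, §4 Definition («A snake of type Dₙ is a sequence (x₁, …, xₙ) of integers such that −x₂ < x₁ < x₂ > x₃ < ⋯ xₙ»)] -/
def dHead : List ℤ → Bool
  | a :: b :: _ => decide (-b < a)
  | _ => true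

/-- **Snakes of type `D`** on a set `T` of absolute values (Arnol'd, Hoffman): signed arrangements
`−x₂ < x₁ < x₂ > x₃ < ⋯` of `T`; Hoffman's `Dₙ` is `dSnakes (range n)` (`{|x₁|, …, |xₙ|} = {0, 1, …, n−1}`).
[cite: Hoffman1999DerivativePolynomials, §4 Definition («A snake of type Dₙ is a sequence (x₁, …, xₙ) of integers such that −x₂ < x₁ < x₂ > x₃ < ⋯ xₙ and {|x₁|, |x₂|, …, |xₙ|} = {0, 1, …, n − 1}»); Arnold1992Snakes] -/
def dSnakes (T : Finset ℕ) : Finset (List ℤ) :=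
  (signedArrangements T).filter fun y => zigzagWord true y = true ∧ dHead y = true

/-- `βₙ⁺`: the `β`-snakes that start with a positive integer. [cite: Hoffman1999DerivativePolynomials, §4 proof of Theorem 4.3 («βₙ⁻ and βₙ⁺ are respectively the sets of βₙ-snakes that start with a negative integer and with a positive integer»)] -/
def betaSnakesPos (S : Finset ℕ) : Finset (List ℤ) := (betaSnakes S).filter fun x => 0 < x.headI

/-- `βₙ⁻`: the `β`-snakes that do not start with a positive integer (for `0 ∉ S ≠ ∅`: that start with a negative one).
[cite: Hoffman1999DerivativePolynomials, §4 proof of Theorem 4.3 («βₙ = βₙ⁻ ∪ βₙ⁺»)] -/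
def betaSnakesNeg (S : Finset ℕ) : Finset (List ℤ) := (betaSnakes S).filter fun x => ¬0 < x.headI

/-- `card βₙ = card βₙ⁺ + card βₙ⁻`. [cite: Hoffman1999DerivativePolynomials, §4 proof of Theorem 4.3 («we have a partition βₙ = βₙ⁻ ∪ βₙ⁺»)] -/
theorem card_betaSnakes_eq_pos_add_neg (S : Finset ℕ) :
    (betaSnakes S).card = (betaSnakesPos S).card + (betaSnakesNeg S).card :=
  (Finset.card_filter_add_card_filter_not _).symm

/-- Small cases: `D₁ = {(0)}`, `D₂ = {(0,1)}`, `card D₃ = 5`, `card D₄ = 23` (`dₙ = Pₙ(1) − Qₙ(1) = 1, 1, 5, 23`).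
[cite: Hoffman1999DerivativePolynomials, §4 Theorem 4.3 («card Dₙ = Pₙ(1) − Qₙ(1)») and §4 («½·… the generating function of the dₙ»)] -/
theorem dSnakes_small_counts :
    (((List.range 1).permutations'.flatMap signings).dedup.countP fun y => zigzagWord true y && dHead y) = 1 ∧
    (((List.range 2).permutations'.flatMap signings).dedup.countP fun y => zigzagWord true y && dHead y) = 1 ∧
    (((List.range 3).permutations'.flatMap signings).dedup.countP fun y => zigzagWord true y && dHead y) = 5 ∧
    (((List.range 3).permutations'.flatMap signings).dedup.filter fun y => zigzagWord true y && dHead y) ~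
      [[0, 2, 1], [0, 2, -1], [1, 2, 0], [-1, 2, 0], [0, 1, -2]] := by
  refine ⟨by decide, by decide, by decide, by decide⟩

/-! ### §2 `f : βₙ⁻ → Bₙ`, `f(x) = −x` -/

/-- Negation preserves the signed arrangements of `S`. [cite: Hoffman1999DerivativePolynomials, §4 proof of Theorem 4.3 («f(x₁, …, xₙ) = (−x₁, …, −xₙ)»)] -/
theorem map_neg_mem_signedArrangements {S : Finset ℕ} {x : List ℤ} (hx : x ∈ signedArrangements S) :
    x.map Neg.neg ∈ signedArrangements S := by
  rw [mem_signedArrangements] at hx ⊢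
  rwa [map_map, show Int.natAbs ∘ Neg.neg = Int.natAbs from funext fun a => Int.natAbs_neg a]

/-- In a signed arrangement of a set of nonzero absolute values, the first letter (if any) is nonzero.
[cite: Hoffman1999DerivativePolynomials, §4 proof of Theorem 4.3 (every βₙ-snake starts with a negative or a positive integer)] -/
theorem headI_ne_zero_of_mem {S : Finset ℕ} (hS : (0 : ℕ) ∉ S) {x : List ℤ} (hx : x ∈ signedArrangements S)
    (hne : x ≠ []) : x.headI ≠ 0 := by
  obtain ⟨a, t, rfl⟩ := List.exists_cons_of_ne_nil hne
  rw [mem_signedArrangements] at hx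
  intro h
  simp only [List.headI_cons] at h
  subst h
  exact hS (by rw [← hx.2]; simp)

/-- ★ **`f` is a bijection of `βₙ⁻` onto `Bₙ`**: `card βₙ⁻(S) = card B(S)` for `0 ∉ S`, `S ≠ ∅` (negation is an
involution exchanging `x₁ < 0, x₁ < x₂ > ⋯` with `0 < −x₁ > −x₂ < ⋯`).
[cite: Hoffman1999DerivativePolynomials, §4 proof of Theorem 4.3 («Let f(x₁, …, xₙ) = (−x₁, …, −xₙ): it is easy to see that f is a bijection of βₙ⁻ onto Bₙ»)] -/
theorem card_betaSnakesNeg {S : Finset ℕ} (hS : (0 : ℕ) ∉ S) (hne : S.Nonempty) :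
    (betaSnakesNeg S).card = (bSnakes S).card := by
  have hnil : ∀ x ∈ signedArrangements S, x ≠ [] := by
    intro x hx h
    subst h
    rw [mem_signedArrangements] at hx
    obtain ⟨a, ha⟩ := hne
    have : a ∈ (([] : List ℤ).map Int.natAbs).toFinset := by rw [hx.2]; exact ha
    simp at this
  have hinv : ∀ x : List ℤ, (x.map Neg.neg).map Neg.neg = x := fun x => by
    rw [map_map]; simp
  refine Finset.card_nbij' (fun x => x.map Neg.neg) (fun x => x.map Neg.neg) ?_ ?_ (fun x _ => hinv x)
    (fun x _ => hinv x)
  · intro x hx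
    rw [Finset.mem_coe, betaSnakesNeg, Finset.mem_filter, betaSnakes, Finset.mem_filter] at hx
    rw [Finset.mem_coe, bSnakes, Finset.mem_filter]
    dsimp only
    refine ⟨map_neg_mem_signedArrangements hx.1.1, ?_⟩
    obtain ⟨a, t, rfl⟩ := List.exists_cons_of_ne_nil (hnil x hx.1.1)
    have ha : a < 0 := lt_of_le_of_ne (not_lt.1 hx.2) (headI_ne_zero_of_mem hS hx.1.1 (cons_ne_nil a t))
    rw [map_cons, zigzagWord_true_cons_cons, ← map_cons, zigzagWord_map_neg]
    exact ⟨by simpa using ha, hx.1.2⟩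
  · intro y hy
    rw [Finset.mem_coe, bSnakes, Finset.mem_filter] at hy
    rw [Finset.mem_coe, betaSnakesNeg, Finset.mem_filter, betaSnakes, Finset.mem_filter]
    dsimp only
    obtain ⟨a, t, rfl⟩ := List.exists_cons_of_ne_nil (hnil y hy.1)
    rw [zigzagWord_true_cons_cons] at hy
    refine ⟨⟨map_neg_mem_signedArrangements hy.1, ?_⟩, ?_⟩
    · rw [zigzagWord_map_neg]; exact hy.2.2
    · simp only [map_cons, List.headI_cons, not_lt, neg_nonpos]; exact hy.2.1.le

/-! ### §3 `g : βₙ⁺ → Dₙ` and its inverse -/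

/-- `x ↦ (sgn x)(|x| − 1)`. [cite: Hoffman1999DerivativePolynomials, §4 proof of Theorem 4.3 («x̃ᵢ = (sgn xᵢ)(|xᵢ| − 1)»)] -/
def shrink (a : ℤ) : ℤ := if 0 < a then a - 1 else if a < 0 then a + 1 else 0

/-- `y ↦ (sgn y)(|y| + 1)` for `y ≠ 0`, and `0 ↦ δ`. [cite: Hoffman1999DerivativePolynomials, §4 proof of Theorem 4.3 («ŷᵢ = (sgn yᵢ)(|yᵢ| + 1) for i ≠ r»)] -/
def grow (δ c : ℤ) : ℤ := if 0 < c then c + 1 else if c < 0 then c - 1 else δ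

/-- The sign `x_r` of the letter of absolute value `1` in `x`. [cite: Hoffman1999DerivativePolynomials, §4 proof of Theorem 4.3 («with r ∈ {1, …, n} such that |x_r| = 1»)] -/
def signOfOne (x : List ℤ) : ℤ := if (1 : ℤ) ∈ x then 1 else -1

/-- **Hoffman's `g`**: `g(x₁, …, xₙ) = (x_r x̃₁, x̃₂, …, x̃ₙ)`. [cite: Hoffman1999DerivativePolynomials, §4 proof of Theorem 4.3 («Then g(x₁, …, xₙ) = (x_r x̃₁, x̃₂, …, x̃ₙ), where x̃ᵢ = (sgn xᵢ)(|xᵢ| − 1)»)] -/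
def gMap : List ℤ → List ℤ
  | [] => []
  | a :: t => (signOfOne (a :: t) * shrink a) :: t.map shrink

/-- `sgn y₁` (with `sgn 0 = 1`, the case `r = 1`). [cite: Hoffman1999DerivativePolynomials, §4 proof of Theorem 4.3 («(1, ŷ₂, …, ŷₙ) if r = 1; (|ŷ₁|, ŷ₂, …, ŷ_{r−1}, sgn y₁, ŷ_{r+1}, …, ŷₙ) otherwise»)] -/
def headSign (b : ℤ) : ℤ := if b < 0 then -1 else 1

/-- **Hoffman's `g⁻¹`**: `(y₁, …, yₙ) ↦ (|ŷ₁|, ŷ₂, …, ŷₙ)` with `ŷᵢ = (sgn yᵢ)(|yᵢ|+1)` for `yᵢ ≠ 0` and `ŷ_r = sgn y₁`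
at the position `r` of the letter `0` (`= 1` if `r = 1`).
[cite: Hoffman1999DerivativePolynomials, §4 proof of Theorem 4.3 («g has an inverse given by g⁻¹(y₁, …, yₙ) = (1, ŷ₂, …, ŷₙ), if r = 1; (|ŷ₁|, ŷ₂, …, ŷ_{r−1}, sgn y₁, ŷ_{r+1}, …, ŷₙ), otherwise»)] -/
def gInv : List ℤ → List ℤ
  | [] => []
  | b :: t => ((grow (headSign b) b).natAbs : ℤ) :: t.map (grow (headSign b))

/-- `|x̃| = |x| − 1`. [cite: Hoffman1999DerivativePolynomials, §4 proof of Theorem 4.3 («x̃ᵢ = (sgn xᵢ)(|xᵢ| − 1)»)] -/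
theorem natAbs_shrink (a : ℤ) : (shrink a).natAbs = a.natAbs - 1 := by
  unfold shrink; split_ifs <;> omega

/-- `|ŷ| = |y| + 1` (`|δ| = 1`). [cite: Hoffman1999DerivativePolynomials, §4 proof of Theorem 4.3 («ŷᵢ = (sgn yᵢ)(|yᵢ| + 1)»)] -/
theorem natAbs_grow {δ : ℤ} (hδ : δ = 1 ∨ δ = -1) (c : ℤ) : (grow δ c).natAbs = c.natAbs + 1 := by
  unfold grow; split_ifs <;> omega

/-- `grow δ ∘ shrink = id` away from `±1`, and at `±1` when `δ` is that sign. [cite: Hoffman1999DerivativePolynomials, §4 proof of Theorem 4.3 («g has an inverse»)] -/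
theorem grow_shrink {δ a : ℤ} (ha : a ≠ 0) (h1 : a.natAbs = 1 → δ = a) : grow δ (shrink a) = a := by
  unfold grow shrink; split_ifs <;> omega

/-- `shrink ∘ grow δ = id` (`|δ| = 1`). [cite: Hoffman1999DerivativePolynomials, §4 proof of Theorem 4.3 («g has an inverse»)] -/
theorem shrink_grow {δ : ℤ} (hδ : δ = 1 ∨ δ = -1) (c : ℤ) : shrink (grow δ c) = c := by
  unfold grow shrink; split_ifs <;> omega

/-- `grow δ` is strictly increasing (`|δ| = 1`). [cite: Hoffman1999DerivativePolynomials, §4 proof of Theorem 4.3 («The reader may verify that the image of g is in Dₙ»)] -/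
theorem grow_strictMono {δ : ℤ} (hδ : δ = 1 ∨ δ = -1) : StrictMono (grow δ) := by
  intro a b hab
  unfold grow; split_ifs <;> omega

/-- `shrink` is strictly increasing on the letters of a word with distinct absolute values (it only identifies
`1` and `−1`). [cite: Hoffman1999DerivativePolynomials, §4 proof of Theorem 4.3 («The reader may verify that the image of g is in Dₙ»)] -/
theorem shrink_strictMonoOn {x : List ℤ} (hx : (x.map Int.natAbs).Nodup) (h0 : (0 : ℤ) ∉ x) :
    StrictMonoOn shrink {a | a ∈ x} := by
  intro a ha b hb hab
  have key : a.natAbs ≠ b.natAbs := fun h => hab.ne (List.inj_on_of_nodup_map hx ha hb h)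
  have ha0 : a ≠ 0 := fun h => h0 (h ▸ ha)
  have hb0 : b ≠ 0 := fun h => h0 (h ▸ hb)
  show shrink a < shrink b
  unfold shrink
  split_ifs <;> omega

/-- The absolute values of `g(x)`: `|x| − 1` letterwise. [cite: Hoffman1999DerivativePolynomials, §4 proof of Theorem 4.3] -/
theorem map_natAbs_gMap (x : List ℤ) : (gMap x).map Int.natAbs = (x.map Int.natAbs).map (· - 1) := by
  cases x with
  | nil => rfl
  | cons a t =>
      simp only [gMap, map_cons, map_map, Int.natAbs_mul, natAbs_shrink, cons.injEq]
      refine ⟨?_, ?_⟩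
      · unfold signOfOne; split_ifs <;> simp
      · exact map_congr_left fun c _ => by simp [natAbs_shrink]

/-- The absolute values of `g⁻¹(y)`: `|y| + 1` letterwise. [cite: Hoffman1999DerivativePolynomials, §4 proof of Theorem 4.3] -/
theorem map_natAbs_gInv (y : List ℤ) : (gInv y).map Int.natAbs = (y.map Int.natAbs).map (· + 1) := by
  have hδ : ∀ b : ℤ, headSign b = 1 ∨ headSign b = -1 := fun b => by unfold headSign; split_ifs <;> simp
  cases y with
  | nil => rfl
  | cons b t =>
      simp only [gInv, map_cons, map_map, Int.natAbs_natCast, natAbs_grow (hδ b), cons.injEq, true_and]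
      exact map_congr_left fun c _ => by simp [natAbs_grow (hδ b)]

/-- Unfolding `βₙ⁺`. [cite: Hoffman1999DerivativePolynomials, §4 proof of Theorem 4.3] -/
theorem mem_betaSnakesPos {S : Finset ℕ} {x : List ℤ} :
    x ∈ betaSnakesPos S ↔ x ∈ signedArrangements S ∧ zigzagWord true x = true ∧ 0 < x.headI := by
  simp [betaSnakesPos, betaSnakes, and_assoc]

/-- Unfolding `D`. [cite: Hoffman1999DerivativePolynomials, §4 Definition (snakes of type Dₙ)] -/
theorem mem_dSnakes {T : Finset ℕ} {y : List ℤ} :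
    y ∈ dSnakes T ↔ y ∈ signedArrangements T ∧ zigzagWord true y = true ∧ dHead y = true := by
  simp [dSnakes]

/-- `toFinset` commutes with `map`. [folklore] -/
private theorem toFinset_map_nat (l : List ℕ) (f : ℕ → ℕ) : (l.map f).toFinset = l.toFinset.image f := by
  ext a
  simp only [List.mem_toFinset, List.mem_map, Finset.mem_image]

/-- `{1,…,n} − 1 = {0,…,n−1}`. [folklore] -/
private theorem image_pred_Icc (n : ℕ) : (Finset.Icc 1 n).image (· - 1) = Finset.range n := by
  ext a
  simp only [Finset.mem_image, Finset.mem_Icc, Finset.mem_range]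
  constructor
  · rintro ⟨b, ⟨h1, h2⟩, rfl⟩; omega
  · intro h; exact ⟨a + 1, ⟨by omega, by omega⟩, by omega⟩

/-- `{0,…,n−1} + 1 = {1,…,n}`. [folklore] -/
private theorem image_succ_range (n : ℕ) : (Finset.range n).image (· + 1) = Finset.Icc 1 n := by
  ext a
  simp only [Finset.mem_image, Finset.mem_Icc, Finset.mem_range]
  constructor
  · rintro ⟨b, h, rfl⟩; omega
  · intro h; exact ⟨a - 1, by omega, by omega⟩

/-- `sgn y₁ ∈ {±1}`. [folklore] -/
private theorem headSign_eq (b : ℤ) : headSign b = 1 ∨ headSign b = -1 := by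
  unfold headSign; split_ifs <;> simp

/-- `x_r ∈ {±1}`. [folklore] -/
private theorem signOfOne_eq (x : List ℤ) : signOfOne x = 1 ∨ signOfOne x = -1 := by
  unfold signOfOne; split_ifs <;> simp

/-- ★ **`g` maps `βₙ⁺` into `Dₙ`** («The reader may verify that the image of g is in Dₙ»).
[cite: Hoffman1999DerivativePolynomials, §4 proof of Theorem 4.3 («The reader may verify that the image of g is in Dₙ»)] -/
theorem gMap_mem {n : ℕ} {x : List ℤ} (hx : x ∈ betaSnakesPos (Finset.Icc 1 n)) :
    gMap x ∈ dSnakes (Finset.range n) := by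
  rw [mem_betaSnakesPos, mem_signedArrangements] at hx
  obtain ⟨⟨hnd, hset⟩, hzz, hpos⟩ := hx
  have hge : ∀ c ∈ x, 1 ≤ c.natAbs := fun c hc => by
    have : c.natAbs ∈ (x.map Int.natAbs).toFinset := by rw [List.mem_toFinset]; exact mem_map_of_mem hc
    rw [hset, Finset.mem_Icc] at this; exact this.1
  have h0 : (0 : ℤ) ∉ x := fun h => by have := hge 0 h; simp at this
  rw [mem_dSnakes, mem_signedArrangements, map_natAbs_gMap]
  refine ⟨⟨hnd.map_on fun u hu v hv huv => ?_, ?_⟩, ?_⟩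
  · obtain ⟨c, hc, rfl⟩ := mem_map.1 hu
    obtain ⟨d, hd, rfl⟩ := mem_map.1 hv
    have := hge c hc; have := hge d hd
    omega
  · rw [toFinset_map_nat, hset, image_pred_Icc]
  · cases x with
    | nil => simp at hpos
    | cons a t =>
        simp only [List.headI_cons] at hpos
        cases t with
        | nil => simp [gMap, dHead]
        | cons b t =>
            have hab : a < b := ((zigzagWord_true_cons_cons a b t).1 hzz).1
            have htail : zigzagWord false (b :: t) = true := ((zigzagWord_true_cons_cons a b t).1 hzz).2
            have hmono := shrink_strictMonoOn hnd h0
            have hmap : zigzagWord false ((b :: t).map shrink) = true := by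
              rw [zigzagWord_map_of_strictMonoOn hmono false (b :: t) fun c hc => mem_cons_of_mem a hc]
              exact htail
            rw [map_cons] at hmap
            simp only [gMap, map_cons, zigzagWord_true_cons_cons, dHead, decide_eq_true_eq]
            refine ⟨⟨?_, hmap⟩, ?_⟩ <;>
            · rcases signOfOne_eq (a :: b :: t) with h | h <;> rw [h] <;> unfold shrink <;> split_ifs <;> omega

/-- ★ **`g⁻¹` maps `Dₙ` into `βₙ⁺`** (`n ≥ 1`). [cite: Hoffman1999DerivativePolynomials, §4 proof of Theorem 4.3 («g has an inverse given by …»)] -/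
theorem gInv_mem {n : ℕ} (hn : 1 ≤ n) {y : List ℤ} (hy : y ∈ dSnakes (Finset.range n)) :
    gInv y ∈ betaSnakesPos (Finset.Icc 1 n) := by
  rw [mem_dSnakes, mem_signedArrangements] at hy
  obtain ⟨⟨hnd, hset⟩, hzz, hhead⟩ := hy
  rw [mem_betaSnakesPos, mem_signedArrangements, map_natAbs_gInv]
  refine ⟨⟨hnd.map fun u v h => by simpa using h, by rw [toFinset_map_nat, hset, image_succ_range]⟩, ?_⟩
  cases y with
  | nil =>
      exfalso
      have : (0 : ℕ) ∈ (([] : List ℤ).map Int.natAbs).toFinset := by rw [hset]; simp; omega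
      simp at this
  | cons b t =>
      have hδ := headSign_eq b
      refine ⟨?_, ?_⟩
      · cases t with
        | nil => simp [gInv]
        | cons c t =>
            have hbc : b < c := ((zigzagWord_true_cons_cons b c t).1 hzz).1
            have htail : zigzagWord false (c :: t) = true := ((zigzagWord_true_cons_cons b c t).1 hzz).2
            have hcb : -c < b := by simpa [dHead] using hhead
            have hmap : zigzagWord false ((c :: t).map (grow (headSign b))) = true := by
              rw [zigzagWord_map_of_strictMonoOn (s := Set.univ) ((grow_strictMono hδ).strictMonoOn _) false
                (c :: t) fun _ _ => trivial]
              exact htail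
            rw [map_cons] at hmap
            simp only [gInv, map_cons, zigzagWord_true_cons_cons]
            refine ⟨?_, hmap⟩
            rw [natAbs_grow hδ]
            unfold grow
            split_ifs <;> omega
      · simp only [gInv, List.headI_cons, natAbs_grow hδ]
        omega

/-- ★ **`g⁻¹ ∘ g = id` on `βₙ⁺`**. [cite: Hoffman1999DerivativePolynomials, §4 proof of Theorem 4.3 («g has an inverse»)] -/
theorem gInv_gMap {n : ℕ} {x : List ℤ} (hx : x ∈ betaSnakesPos (Finset.Icc 1 n)) : gInv (gMap x) = x := by
  rw [mem_betaSnakesPos, mem_signedArrangements] at hx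
  obtain ⟨⟨hnd, hset⟩, -, hpos⟩ := hx
  have hge : ∀ c ∈ x, 1 ≤ c.natAbs := fun c hc => by
    have : c.natAbs ∈ (x.map Int.natAbs).toFinset := by rw [List.mem_toFinset]; exact mem_map_of_mem hc
    rw [hset, Finset.mem_Icc] at this; exact this.1
  have hinj := List.inj_on_of_nodup_map hnd
  cases x with
  | nil => simp at hpos
  | cons a t =>
      simp only [List.headI_cons] at hpos
      have hε := signOfOne_eq (a :: t)
      have hε1 : (1 : ℤ) ∈ a :: t → signOfOne (a :: t) = 1 := fun h => by simp [signOfOne, h]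
      have hεm : (-1 : ℤ) ∈ a :: t → signOfOne (a :: t) = -1 := fun h => by
        have h1 : (1 : ℤ) ∉ a :: t := fun h1 => by have := hinj h h1 (by simp); omega
        simp [signOfOne, h1]
      have ha1 : a = 1 → signOfOne (a :: t) = 1 := fun h => hε1 (by rw [h]; exact mem_cons_self)
      have hδ : headSign (signOfOne (a :: t) * shrink a) = signOfOne (a :: t) := by
        rcases hε with h | h <;> rw [h] <;> unfold headSign shrink <;> split_ifs <;> omega
      simp only [gMap, gInv, hδ, map_map, cons.injEq]
      refine ⟨?_, ?_⟩
      · rcases hε with h | h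
        · rw [h]; unfold grow shrink; split_ifs <;> omega
        · have : a ≠ 1 := fun h1 => by rw [ha1 h1] at h; omega
          rw [h]; unfold grow shrink; split_ifs <;> omega
      · conv_rhs => rw [← map_id t]
        refine map_congr_left fun c hc => ?_
        have hc0 : c ≠ 0 := fun h => by have := hge c (mem_cons_of_mem a hc); rw [h] at this; simp at this
        refine grow_shrink hc0 fun h1 => ?_
        rcases Int.natAbs_eq c with h | h <;> rw [h1] at h <;> push_cast at h
        · rw [h]; exact hε1 (h ▸ mem_cons_of_mem a hc)
        · rw [h]; exact hεm (h ▸ mem_cons_of_mem a hc)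

/-- ★ **`g ∘ g⁻¹ = id` on `Dₙ`** (`n ≥ 1`). [cite: Hoffman1999DerivativePolynomials, §4 proof of Theorem 4.3 («g has an inverse given by …»)] -/
theorem gMap_gInv {n : ℕ} {y : List ℤ} (hy : y ∈ dSnakes (Finset.range n)) : gMap (gInv y) = y := by
  rw [mem_dSnakes, mem_signedArrangements] at hy
  obtain ⟨⟨hnd, hset⟩, -, -⟩ := hy
  cases y with
  | nil => rfl
  | cons b t =>
      have hδ := headSign_eq b
      -- the letter `0` occurs in `y`
      have h0 : (0 : ℤ) ∈ b :: t := by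
        have : (0 : ℕ) ∈ ((b :: t).map Int.natAbs).toFinset := by
          rw [hset, Finset.mem_range]
          have : ((b :: t).map Int.natAbs).length = n := by
            rw [← List.toFinset_card_of_nodup hnd, hset, Finset.card_range]
          simp at this; omega
        rw [List.mem_toFinset, mem_map] at this
        obtain ⟨e, he, he0⟩ := this
        rwa [Int.natAbs_eq_zero.1 he0] at he
      have htail : (t.map (grow (headSign b))).map shrink = t := by
        rw [map_map]
        conv_rhs => rw [← map_id t]
        exact map_congr_left fun c _ => shrink_grow hδ c
      have hε : signOfOne (gInv (b :: t)) = if 0 ≤ b then 1 else -1 := by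
        unfold signOfOne
        simp only [gInv, mem_cons, mem_map]
        split_ifs with h1 h2 h2
        · rfl
        · exfalso
          rcases h1 with h1 | ⟨c, hc, h1⟩
          · rw [natAbs_grow hδ] at h1; omega
          · unfold grow headSign at h1; split_ifs at h1 <;> omega
        · exfalso
          rcases eq_or_ne b 0 with hb | hb
          · exact h1 (Or.inl (by rw [natAbs_grow hδ, hb]; simp))
          · refine h1 (Or.inr ⟨0, ?_, ?_⟩)
            · rcases (mem_cons.1 h0) with h | h
              · exact absurd h.symm hb
              · exact h
            · unfold grow headSign; split_ifs <;> omega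
        · rfl
      show (signOfOne (gInv (b :: t)) * shrink ((grow (headSign b) b).natAbs : ℤ)) ::
          (t.map (grow (headSign b))).map shrink = b :: t
      rw [htail, hε, natAbs_grow hδ]
      congr 1
      unfold shrink
      split_ifs <;> omega

/-- ★★ **`g` is a bijection of `βₙ⁺` onto `Dₙ`**: `card βₙ⁺ = card Dₙ` (`n ≥ 1`).
[cite: Hoffman1999DerivativePolynomials, §4 proof of Theorem 4.3 («We shall define bijections f : βₙ⁻ → Bₙ and g : βₙ⁺ → Dₙ»)] -/
theorem card_betaSnakesPos_eq_card_dSnakes {n : ℕ} (hn : 1 ≤ n) :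
    (betaSnakesPos (Finset.Icc 1 n)).card = (dSnakes (Finset.range n)).card :=
  Finset.card_nbij' gMap gInv (fun _ hx => gMap_mem hx) (fun _ hy => gInv_mem hn hy) (fun _ hx => gInv_gMap hx)
    fun _ hy => gMap_gInv hy

/-! ### §4 Theorem 4.3 -/

/-- ★★★ **Theorem 4.3**: `card βₙ = card Bₙ + card Dₙ` (`n ≥ 1`).
[cite: Hoffman1999DerivativePolynomials, §4 Theorem 4.3 («card βₙ = card Bₙ + card Dₙ»)] -/
theorem card_betaSnakes_eq_card_bSnakes_add_card_dSnakes {n : ℕ} (hn : 1 ≤ n) :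
    (betaSnakes (Finset.Icc 1 n)).card = (bSnakes (Finset.Icc 1 n)).card + (dSnakes (Finset.range n)).card := by
  rw [card_betaSnakes_eq_pos_add_neg, card_betaSnakesPos_eq_card_dSnakes hn,
    card_betaSnakesNeg (by simp) ⟨1, by simp; omega⟩, add_comm]

/-- ★★★ **Theorem 4.3, second half**: `card Dₙ = Pₙ(1) − Qₙ(1) = dₙ`, the Springer number of type `Dₙ`
(Proposition 4.1), for `n ≥ 1`. [cite: Hoffman1999DerivativePolynomials, §4 Theorem 4.3 («so card Dₙ = Pₙ(1) − Qₙ(1)») and Proposition 4.1 («dₙ = Pₙ(1) − Qₙ(1)»)] -/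
theorem card_dSnakes_range {n : ℕ} (hn : 1 ≤ n) :
    (dSnakes (Finset.range n)).card = (TangentNumbers.P n).eval 1 - (TangentNumbers.Q n).eval 1 := by
  have h := card_betaSnakes_eq_card_bSnakes_add_card_dSnakes hn
  rw [card_betaSnakes_Icc, card_bSnakes_Icc] at h
  omega

/-- The Springer numbers of type `D`: `card D₁, …, card D₆ = 1, 1, 5, 23, 151, 1141`.
[cite: Hoffman1999DerivativePolynomials, §4 Proposition 4.1 (dₙ); Arnold1992Snakes (the table of dₙ)] -/
theorem card_dSnakes_values :
    [(dSnakes (Finset.range 1)).card, (dSnakes (Finset.range 2)).card, (dSnakes (Finset.range 3)).card,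
      (dSnakes (Finset.range 4)).card, (dSnakes (Finset.range 5)).card, (dSnakes (Finset.range 6)).card] =
      [1, 1, 5, 23, 151, 1141] := by
  have hP := DerivativePolynomials.eval_one_P_values
  have hQ := DerivativePolynomials.eval_one_Q_values
  simp only [List.cons.injEq, and_true] at hP hQ
  simp only [card_dSnakes_range (show 1 ≤ 1 by norm_num), card_dSnakes_range (show 1 ≤ 2 by norm_num),
    card_dSnakes_range (show 1 ≤ 3 by norm_num), card_dSnakes_range (show 1 ≤ 4 by norm_num),
    card_dSnakes_range (show 1 ≤ 5 by norm_num), card_dSnakes_range (show 1 ≤ 6 by norm_num),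
    hP.2.1, hP.2.2.1, hP.2.2.2.1, hP.2.2.2.2.1, hP.2.2.2.2.2.1, hP.2.2.2.2.2.2,
    hQ.2.1, hQ.2.2.1, hQ.2.2.2.1, hQ.2.2.2.2.1, hQ.2.2.2.2.2.1, hQ.2.2.2.2.2.2.1]

/-- ★ The generating function: `Σ_{n≥1} card Dₙ tⁿ/n! = P(1,t) − Q(1,t)` (`= (1 + sin 2t − cos t − sin t)/cos 2t`,
`DerivativePolynomials.egfP_sub_egfQ_one_mul_cos_two`; the constant terms differ: `card D₀ = 1`, `P₀(1) − Q₀(1) = 0`).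
[cite: Hoffman1999DerivativePolynomials, §4 (3) («If R is of type Dₙ … dₙ satisfies … = (1 + sin 2t − cos t − sin t)/cos 2t») and Theorem 4.3] -/
theorem egf_dSnakes :
    PowerSeries.mk (fun n => if n = 0 then (0 : ℚ) else ((dSnakes (Finset.range n)).card : ℚ) / n.factorial) =
      DerivativePolynomials.egfP (1 : ℚ) - DerivativePolynomials.egfQ 1 := by
  ext n
  rw [PowerSeries.coeff_mk, map_sub, DerivativePolynomials.coeff_egfP, DerivativePolynomials.coeff_egfQ,
    DerivativePolynomials.aeval_one_nat, DerivativePolynomials.aeval_one_nat, ← sub_div]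
  split_ifs with h
  · subst h; simp [TangentNumbers.P_zero, TangentNumbers.Q]
  · rw [card_dSnakes_range (Nat.one_le_iff_ne_zero.2 h),
      Nat.cast_sub (DerivativePolynomials.eval_one_Q_le_eval_one_P n)]

end Snakes
end Literature.Combinatorics.Enumerative
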